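import Summits.AtomisticToContinuum.BoseEinsteinCondensation.Theses.BECPeriodicReduction
import Summits.AtomisticToContinuum.BoseEinsteinCondensation.Theses.BECInsertionCorrector
import Summits.AtomisticToContinuum.BoseEinsteinCondensation.Theses.BECGroundStateSOS
import Literature.MathematicalPhysics.QuantumManyBody.BogoliubovSpectrumGP
import Summits.AtomisticToContinuum.BoseEinsteinCondensation.Theorems.BECGroundStateSOSRimSqueezeDefs
import Summits.AtomisticToContinuum.BoseEinsteinCondensation.Theorems.BECGroundStateSOSBoundaryTransferWeakTorusGapLocallyBounded
import Summits.AtomisticToContinuum.BoseEinsteinCondensation.Theorems.BECGroundStateSOSBoundaryTransferWeakTorusCoreFloor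
import Summits.AtomisticToContinuum.BoseEinsteinCondensation.Theorems.BECGroundStateSOSBoundaryTransferWeakHardWallLimitLocallyBounded
import Summits.AtomisticToContinuum.BoseEinsteinCondensation.Theorems.BECGroundStateSOSBoundaryTransferWeakTorusGapHardCoreOfLemmaG
import Summits.AtomisticToContinuum.BoseEinsteinCondensation.Theorems.BECGroundStateSOSBoundaryTransferWeakDirichletEndpoint

/-!
# Line `rim-squeeze-monotone-coherence` — crux `BoundaryTransferWeak` (stmt-AtomisticToContinuum-0827)

Lead c3 working skeleton v3 (`work/BoundaryTransferWeak.lean`, from `Lines/rim_squeeze_monotone_coherence.lean`;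
adds the `BECGroundStateSOS` copy of the conclusion by name). The ramp vocabulary (`rimPot`, `coreMode`,
`rimEnergy`, `rampEnergy`, `rampGroundStateEnergy`, `rampOccupation`, `coreOcc`) is the LANDED route Defs file
`Theorems/BECGroundStateSOSRimSqueezeDefs.lean` (p154285, namespace `…BoseEinsteinCondensation.RimSqueeze`).

Skeleton (crux-plan, round 1) of the idea card `Ideas/rim-squeeze-monotone-coherence.md` (ideator 2;
triage r1-1 PASS, r1-2 PASS), sharpened by the panel notes.

THE LEVER. One stoquastic coupling path on ONE Hilbert space, from the `A`-exact torus to the Dirichlet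
cube: on the torus of side `L' = sideLength ρ' N` (cell `[0,L')³`) put
`H_t = H^per + t · Σ_j 1_rim(x_j)`, `rim = {x ∈ cell : ∃ k, L'/2 ≤ x_k}` (the complement of the cube
`Q = [0, L'/2)³`), `t ∈ [0, ∞]`. At `t = 0` the ground state is THE torus ground state at density `ρ'`
(where `A(v)` is consumed, once); at `t = ⊤` (periodic `C¹` states vanishing whenever a particle is in the
rim) the problem IS the Dirichlet problem of the cube of side `L'/2 = sideLength (8ρ') N` (conclusion
`B` at density `8ρ'`). The transported quantity is the flat-mode occupation of the CORE
`C = (L'/8, 3L'/8)³` (middle half of `Q`) in the ground state of `H_t`, `coreOcc v t N ρ'`, read through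
near-minimisers exactly as `condensateNumber` (`sup_δ inf`). Compression of a conserved, mobile, dilute
gas RAISES the core condensate DENSITY (`(ρ f(ρ))' > 0`), which is the one mechanism that orders the
Dirichlet side ABOVE the periodic side (every GKS/heat-kernel/Fröhlich–Park monotonicity goes the other
way); only a SIGN along the path is needed, never a size.

THE STUBS (6; `sorry` occurs only inside them), in the order the composition consumes them:
* `stub_torusGap` (G) — Ky Fan gap of the torus Hamiltonian, eventually in `N` at small density
  (= `PeriodicGroundStateNondegenerate[Integrable]_holds` for bounded / integrable `v`; hard cores open).
* `stub_torusCoreFloor` (T) — at fixed `N`: Ky Fan gap + the torus BEC criterion of `A` (constant `c`)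
  ⟹ `coreOcc v 0 N ρ' ≥ (c/128) N` (near-minimiser stability up to phase + translation covariance +
  PSD Cauchy–Schwarz over the 64 translates of `C`; `δ`-erasure honoured: no slack is chosen by us).
* `stub_weakPushLeg` (W) — leaving the torus: for every `ε` some `N`-independent `t₁ > 0` with
  `coreOcc(0) ≤ coreOcc(t) + εN` for all `t ≤ t₁`, eventually in `N` (static linear response of the
  translation-invariant torus ground state to the rim push: sign of the cross-susceptibility
  `χ_{O_C,W}(0) ≤ 0` — "a long-wavelength trough attracts condensate" — with LDA-size remainder; the
  stub where the host route's torus response machinery bites).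
* `stub_squeezeLeg` (S) — the heart: `coreOcc(t₁) ≤ coreOcc(t) + εN` for all finite `t ≥ t₁ > 0`,
  eventually in `N` (persistence and monotonicity of core coherence under finite compression of the
  inhomogeneous ground states `Φ_t`; research depth, ranked hardest).
* `stub_hardWallLimit` (L) — fixed `N`: `limsup_{t→∞} coreOcc(t) ≤ coreOcc(⊤)` (monotone convergence of
  the forms `H_t ↑ H_D ⊕ ∞`, Rellich on the torus, Dirichlet ground-state rigidity on `Q^N`).
* `stub_dirichletEndpoint` (D) — `coreOcc(⊤) ≥ cN` eventually ⟹ `HasGroundStateBEC v (8ρ')` (`C¹`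
  matching of rim-vanishing periodic states with `TrialState N (L'/2)`, `occupation_le_maxOccupation`,
  `le_condensateNumber`, `sideLength (8ρ') N = L'/2`).
COMPOSITION `BoundaryTransferWeak_of` (kernel-checked, no `sorry`): thresholds; `A` at `ρ' = ρ/8` and (G)
feed (T): floor `(c/128)N` at `t = 0`; (W) at `ε = c/512` gives `t₁`; (S) from `t₁` to
`t = max t₀ t₁` with `t₀ = t₀(N)` from (L) at `η = (c/512)N`; three losses of `(c/512)N` leave
`coreOcc(⊤) ≥ (c/512)N`; (D) turns it into `HasGroundStateBEC v (8 · ρ/8) = … v ρ`. It concludes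
`Theses.BECPeriodicReduction.BoundaryTransferWeak` BY NAME (the item's registered decl) and, verbatim the
same statement, `Theses.BECInsertionCorrector.BoundaryTransferWeak` (primary route of this crux-plan).

DISPROOF USED (`Cruxes/BoundaryTransferWeak/Disproof.lean`, cycle 1, RESISTS; no `_false_without_<H>`
theorem exists — `withoutAntecedent_iff_conjunct`: dropping `A` is the conjunct): `A` is load-bearing here
through (T) only; §2 δ-erasure honoured ((T) is stated for the criterion's own `δ`); §3/§5a no Dirichlet
state is ever periodised INTO `A`, no energy is compared across boundary conditions (all energies live in
the one family `H_t`); §5b no window; §5c `not_flatModeTransferSameConstant` respected — the landing is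
in the CORE flat mode with the explicit loss `c ↦ c/512` and the exit is mode-free (`maxOccupation`), and at
`v = 0` every stub instance holds (torus gap: Laplacian; (W),(S): kit j023755/j023771 monotone one-body
ramp; (L): finite-dimensional-type convergence; (D): `hasGroundStateBEC_zero`-compatible).
-/

noncomputable section

/-! ## The line: stubs and composition (namespace `…RimSqueeze.Line`; landed stubs live in
`…RimSqueeze` itself, as `RimSqueeze.stub_<name>`, and are plugged in here by name) -/

namespace Summit.AtomisticToContinuum.BoseEinsteinCondensation.RimSqueeze.Line

open Literature.MathematicalPhysics.QuantumManyBody.BoseGas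
open MeasureTheory Filter Set
open scoped ENNReal NNReal ComplexConjugate

/-! ## The stubs (skeleton v3, lead c3 after waves 1–2)

Landed (plugged in by name below): (T) `RimSqueeze.stub_torusCoreFloor` (p156370, + Aux p156020), (D)
`RimSqueeze.stub_dirichletEndpoint` (p155818), the locally-bounded class of (G)
`RimSqueeze.stub_torusGap_locallyBounded` (p155109), the hard-core class of (G) CONDITIONALLY on Lemma G
`RimSqueeze.stub_torusGap_hardCore_of_lemmaG` (p159499), and the locally-bounded class of (L)
`RimSqueeze.stub_hardWallLimit_locallyBounded` (p161447, chain p160928 p161104 on top of the bounded chain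
p156140 p156794 p156945 p157190 p157352 p158115 p158453 p158751).
Shape: (W)+(S) of v1 merged into ONE leg (M) `stub_rimMonotone`; (G) and (L) are case splits on the potential
class — locally bounded on `(0,∞)` (landed) versus SINGULAR (registered residues `stub_torusGap_singular`,
`stub_hardWallLimit_singular`: hard cores `⊤·1_{[0,a)}` need Lemma G of crux `HardCoreExtension` stmt-11786 for
(G) and Dirichlet rigidity stmt-9072 (b/c) + a hard-core transfer for (L); exotic `⊤`-patterns are the residue
`stub_essExoticTruncationGap` of stmt-11786). `sorry` occurs only in `stub_torusGap_singular`, `stub_rimMonotone`,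
`stub_hardWallLimit_singular`. -/

/-- **Residual stub (G-sing) — torus Ky Fan gap, SINGULAR class.** The registered `stub_torusGap` for
the admissible potentials that are NOT bounded on every `(δ, ∞)` (so `v` takes the value `⊤`, or is
unbounded, near some positive radius: hard cores `⊤·1_{[0,a]}`, hard shells, exotic `⊤`-patterns). For
genuine hard cores this is Faris–Simon irreducibility on the dilute torus hard-sphere free region modulo
`S_N`, eventually in `N` — `kyFanGap_hardCore_of_transitive` takes exactly that transitivity (Lemma G of
crux `HardCoreExtension`, stmt-AtomisticToContinuum-11786, registered there as `stub_lemmaGConnected`) as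
hypothesis, and `RimSqueeze.stub_torusGap_hardCore_of_lemmaG` (LANDED p159499) records (G) for this class conditionally on
Lemma G; open in print (Baryshnikov–Bubenik–Kahle 2014 §6). Exotic `⊤`-classes: residue of stmt-11786. [folklore] -/
theorem stub_torusGap_singular :
    ∀ v : ℝ → ℝ≥0∞, IsRepulsiveFiniteRange v →
      ¬ (∀ δ : ℝ, 0 < δ → ∃ M : ℝ≥0∞, M ≠ ⊤ ∧ ∀ r : ℝ, δ < r → v r ≤ M) →
      ∃ ρ₁ : ℝ, 0 < ρ₁ ∧ ∀ ρ' : ℝ, 0 < ρ' → ρ' < ρ₁ →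
      ∀ᶠ N : ℕ in atTop,
        2 * periodicGroundStateEnergy v N (sideLength ρ' N) < kyFanTwo v N (sideLength ρ' N) := by
  sorry

/-- **Stub (G) — torus Ky Fan gap at small density, every admissible `v`**: case split on the potential
class — locally bounded on `(0,∞)` (LANDED, `RimSqueeze.stub_torusGap_locallyBounded`, from
`kyFanGap_of_locallyBounded` + Ruelle finiteness + `L' → ∞`) versus singular (`stub_torusGap_singular`).
[folklore] -/
theorem stub_torusGap :
    ∀ v : ℝ → ℝ≥0∞, IsRepulsiveFiniteRange v → ∃ ρ₁ : ℝ, 0 < ρ₁ ∧ ∀ ρ' : ℝ, 0 < ρ' → ρ' < ρ₁ →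
      ∀ᶠ N : ℕ in atTop,
        2 * periodicGroundStateEnergy v N (sideLength ρ' N) < kyFanTwo v N (sideLength ρ' N) := by
  intro v hv
  by_cases hlb : ∀ δ : ℝ, 0 < δ → ∃ M : ℝ≥0∞, M ≠ ⊤ ∧ ∀ r : ℝ, δ < r → v r ≤ M
  · exact RimSqueeze.stub_torusGap_locallyBounded v hv hlb
  · exact stub_torusGap_singular v hv hlb

/-- **Stub (T) — torus core floor** (LANDED: `RimSqueeze.stub_torusCoreFloor`, p156370). [folklore] -/
theorem stub_torusCoreFloor :
    ∀ v : ℝ → ℝ≥0∞, IsRepulsiveFiniteRange v → ∀ ρ' : ℝ, 0 < ρ' → ∀ c : ℝ, 0 < c → ∀ N : ℕ,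
      2 * periodicGroundStateEnergy v N (sideLength ρ' N) < kyFanTwo v N (sideLength ρ' N) →
      (∃ δ : ℝ≥0∞, 0 < δ ∧ ∀ Ψ : PeriodicTrialState N (sideLength ρ' N),
          periodicEnergy v Ψ ≤ periodicGroundStateEnergy v N (sideLength ρ' N) + δ →
            ENNReal.ofReal (c * N) ≤ condensateOccupation N (sideLength ρ' N) Ψ.ψ) →
      ENNReal.ofReal (c / 128 * N) ≤ coreOcc v 0 N ρ' :=
  RimSqueeze.stub_torusCoreFloor

/-- **Stub (M) — rim monotonicity (the merged (W)+(S) leg; the heart, research depth).** For every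
admissible `v`, below some density, for every `ε > 0`, eventually in `N`, for ALL finite couplings
`t ≥ 0`: `coreOcc(0) ≤ coreOcc(t) + εN` — pushing the gas out of the rim, however hard, never lowers the
core condensate occupation by a macroscopic amount. Thermodynamic content (lead's analysis, wave 1 (W)
worker's note `work/stubs/WeakPushLeg.md`): with `m(t) = lim coreOcc(t)/N`, in LDA the core density is
`n_c(t) = min(ρ' + 7t/(8g), 8ρ')`, `g = 8πa`, and `m(t) = F(n_c(t))/(64ρ')` with `F(n) = n f(n)` the
condensate density of the homogeneous gas; (M) reads `F(n) ≥ F(ρ')` for `n ∈ [ρ', 8ρ']` — true with a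
macroscopic margin for the dilute gas (LHY: `F(n) = n − (8/(3√π)) a^{3/2} n^{3/2}`), false at solid
densities, so no positivity/convexity proof can exist and a proof needs quantitative control of the
condensate of the INHOMOGENEOUS dilute ground states `Φ_t` (persistence of condensation under
compression): B-depth. Free gas: one-body ramp, numerically monotone (kit j023755/j023771). Weaker than
(W)∧(S) of skeleton v1 and all the composition needs. [folklore] -/
theorem stub_rimMonotone :
    ∀ v : ℝ → ℝ≥0∞, IsRepulsiveFiniteRange v → ∃ ρ₁ : ℝ, 0 < ρ₁ ∧ ∀ ρ' : ℝ, 0 < ρ' → ρ' < ρ₁ →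
      ∀ ε : ℝ, 0 < ε → ∀ᶠ N : ℕ in atTop, ∀ t : ℝ≥0,
        coreOcc v 0 N ρ' ≤ coreOcc v (t : ℝ≥0∞) N ρ' + ENNReal.ofReal (ε * N) := by
  sorry

/-- **Residual stub (L-sing) — hard-wall limit, SINGULAR class.** The registered `stub_hardWallLimit` for the
admissible potentials that are NOT bounded on every `(δ, ∞)` (hard cores, hard shells, exotic `⊤`-patterns). Along
the landed route (`stub_hardWallLimit_aux`: soft assembly from Dirichlet rigidity of the cube + a near-minimiser
transfer) this needs (i) Dirichlet ground-state rigidity for hard cores (stmt-9072 classes b/c,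
`groundStateRigidity_hardCore_of_cubeConnected` — conditional on cube connectivity) and (ii) a hard-core transfer
(the landed dilation step is fatal at contact; a different device is needed). As typed the statement FAILS on a
degenerate Dirichlet ground space (`coreOcc(⊤)` is the infimum over ground states), so (i) is not an artefact.
[folklore] -/
theorem stub_hardWallLimit_singular :
    ∀ v : ℝ → ℝ≥0∞, IsRepulsiveFiniteRange v →
      ¬ (∀ δ : ℝ, 0 < δ → ∃ M : ℝ≥0∞, M ≠ ⊤ ∧ ∀ r : ℝ, δ < r → v r ≤ M) →
      ∃ ρ₁ : ℝ, 0 < ρ₁ ∧ ∀ ρ' : ℝ, 0 < ρ' → ρ' < ρ₁ →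
      ∀ᶠ N : ℕ in atTop, ∀ η : ℝ, 0 < η → ∃ t₀ : ℝ≥0, ∀ t : ℝ≥0, t₀ ≤ t →
        coreOcc v (t : ℝ≥0∞) N ρ' ≤ coreOcc v ⊤ N ρ' + ENNReal.ofReal η := by
  sorry

/-- **Stub (L) — hard-wall limit at fixed `N`, every admissible `v`**: case split — locally bounded on `(0,∞)`
(LANDED, `RimSqueeze.stub_hardWallLimit_locallyBounded`, p161447: rim-layer cutoff + pair-collision cutoff +
dilation + `L²`-modulus transfer of near-minimisers, Dirichlet rigidity of the cube from stmt-9072; the bounded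
sub-class is p158751) versus singular (`stub_hardWallLimit_singular`). [folklore] -/
theorem stub_hardWallLimit :
    ∀ v : ℝ → ℝ≥0∞, IsRepulsiveFiniteRange v → ∃ ρ₁ : ℝ, 0 < ρ₁ ∧ ∀ ρ' : ℝ, 0 < ρ' → ρ' < ρ₁ →
      ∀ᶠ N : ℕ in atTop, ∀ η : ℝ, 0 < η → ∃ t₀ : ℝ≥0, ∀ t : ℝ≥0, t₀ ≤ t →
        coreOcc v (t : ℝ≥0∞) N ρ' ≤ coreOcc v ⊤ N ρ' + ENNReal.ofReal η := by
  intro v hv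
  by_cases hlb : ∀ δ : ℝ, 0 < δ → ∃ M : ℝ≥0∞, M ≠ ⊤ ∧ ∀ r : ℝ, δ < r → v r ≤ M
  · exact RimSqueeze.stub_hardWallLimit_locallyBounded v hv hlb
  · exact stub_hardWallLimit_singular v hv hlb

/-- **Stub (D) — Dirichlet endpoint** (LANDED: `RimSqueeze.stub_dirichletEndpoint`, p155818). [folklore] -/
theorem stub_dirichletEndpoint :
    ∀ v : ℝ → ℝ≥0∞, IsRepulsiveFiniteRange v → ∀ ρ' : ℝ, 0 < ρ' →
      (∃ c : ℝ, 0 < c ∧ ∀ᶠ N : ℕ in atTop, ENNReal.ofReal (c * N) ≤ coreOcc v ⊤ N ρ') →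
        HasGroundStateBEC v (8 * ρ') :=
  RimSqueeze.stub_dirichletEndpoint

/-! ## The composition (kernel-checked, no `sorry`) -/

/-- Real-number bookkeeping of the composition: `c/128 = c/256 + 2·(c/512)`. [folklore] -/
theorem ofReal_split (c : ℝ) (hc : 0 < c) (N : ℕ) :
    ENNReal.ofReal (c / 128 * N) =
      ENNReal.ofReal (c / 256 * N) + (ENNReal.ofReal (c / 512 * N) + ENNReal.ofReal (c / 512 * N)) := by
  rw [← ENNReal.ofReal_add (by positivity) (by positivity),
    ← ENNReal.ofReal_add (by positivity) (by positivity)]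
  congr 1
  ring

/-- **The per-potential transfer from the five stubs** (spelled out; `defeq` to every route's
`BoundaryTransferWeak`). For `ρ < 8·min(ρ_A, ρ_G, ρ_M, ρ_L)` run the ramp at `ρ' = ρ/8`: `A` + (G) + (T)
give the floor `(c/128)N` at `t = 0`; (L) with `η = (c/512)N` gives `t₀ = t₀(N)`; (M) at `ε = c/512` and
`t = t₀` carries the floor to `t₀`, (L) to `t = ⊤`; the two losses leave `(c/256)N ≤ coreOcc(⊤)`; (D)
concludes `HasGroundStateBEC v (8·ρ/8)`. [folklore] -/
theorem boundaryTransfer_of_stubs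
    (hG : ∀ v : ℝ → ℝ≥0∞, IsRepulsiveFiniteRange v → ∃ ρ₁ : ℝ, 0 < ρ₁ ∧ ∀ ρ' : ℝ, 0 < ρ' → ρ' < ρ₁ →
      ∀ᶠ N : ℕ in atTop,
        2 * periodicGroundStateEnergy v N (sideLength ρ' N) < kyFanTwo v N (sideLength ρ' N))
    (hT : ∀ v : ℝ → ℝ≥0∞, IsRepulsiveFiniteRange v → ∀ ρ' : ℝ, 0 < ρ' → ∀ c : ℝ, 0 < c → ∀ N : ℕ,
      2 * periodicGroundStateEnergy v N (sideLength ρ' N) < kyFanTwo v N (sideLength ρ' N) →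
      (∃ δ : ℝ≥0∞, 0 < δ ∧ ∀ Ψ : PeriodicTrialState N (sideLength ρ' N),
          periodicEnergy v Ψ ≤ periodicGroundStateEnergy v N (sideLength ρ' N) + δ →
            ENNReal.ofReal (c * N) ≤ condensateOccupation N (sideLength ρ' N) Ψ.ψ) →
      ENNReal.ofReal (c / 128 * N) ≤ coreOcc v 0 N ρ')
    (hM : ∀ v : ℝ → ℝ≥0∞, IsRepulsiveFiniteRange v → ∃ ρ₁ : ℝ, 0 < ρ₁ ∧ ∀ ρ' : ℝ, 0 < ρ' → ρ' < ρ₁ →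
      ∀ ε : ℝ, 0 < ε → ∀ᶠ N : ℕ in atTop, ∀ t : ℝ≥0,
        coreOcc v 0 N ρ' ≤ coreOcc v (t : ℝ≥0∞) N ρ' + ENNReal.ofReal (ε * N))
    (hL : ∀ v : ℝ → ℝ≥0∞, IsRepulsiveFiniteRange v → ∃ ρ₁ : ℝ, 0 < ρ₁ ∧ ∀ ρ' : ℝ, 0 < ρ' → ρ' < ρ₁ →
      ∀ᶠ N : ℕ in atTop, ∀ η : ℝ, 0 < η → ∃ t₀ : ℝ≥0, ∀ t : ℝ≥0, t₀ ≤ t →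
        coreOcc v (t : ℝ≥0∞) N ρ' ≤ coreOcc v ⊤ N ρ' + ENNReal.ofReal η)
    (hD : ∀ v : ℝ → ℝ≥0∞, IsRepulsiveFiniteRange v → ∀ ρ' : ℝ, 0 < ρ' →
      (∃ c : ℝ, 0 < c ∧ ∀ᶠ N : ℕ in atTop, ENNReal.ofReal (c * N) ≤ coreOcc v ⊤ N ρ') →
        HasGroundStateBEC v (8 * ρ')) :
    ∀ v : ℝ → ℝ≥0∞, IsRepulsiveFiniteRange v →
      (∃ ρ₀ : ℝ, 0 < ρ₀ ∧ ∀ ρ : ℝ, 0 < ρ → ρ < ρ₀ → ∃ c : ℝ, 0 < c ∧ ∀ᶠ N : ℕ in atTop,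
        ∃ δ : ℝ≥0∞, 0 < δ ∧ ∀ Ψ : PeriodicTrialState N (sideLength ρ N),
          periodicEnergy v Ψ ≤ periodicGroundStateEnergy v N (sideLength ρ N) + δ →
            ENNReal.ofReal (c * N) ≤ condensateOccupation N (sideLength ρ N) Ψ.ψ) →
      ∃ ρ₀ : ℝ, 0 < ρ₀ ∧ ∀ ρ : ℝ, 0 < ρ → ρ < ρ₀ → HasGroundStateBEC v ρ := by
  intro v hv hA
  obtain ⟨ρA, hρA, hA'⟩ := hA
  obtain ⟨ρG, hρG, hG'⟩ := hG v hv
  obtain ⟨ρM, hρM, hM'⟩ := hM v hv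
  obtain ⟨ρL, hρL, hL'⟩ := hL v hv
  -- the common density threshold of the ramp, and the route's threshold `8ρ⋆`
  set ρs : ℝ := min ρA (min ρG (min ρM ρL)) with hρs_def
  have hρs : 0 < ρs := lt_min hρA (lt_min hρG (lt_min hρM hρL))
  have hsA : ρs ≤ ρA := min_le_left _ _
  have hsG : ρs ≤ ρG := (min_le_right _ _).trans (min_le_left _ _)
  have hsM : ρs ≤ ρM := (min_le_right _ _).trans ((min_le_right _ _).trans (min_le_left _ _))
  have hsL : ρs ≤ ρL := (min_le_right _ _).trans ((min_le_right _ _).trans (min_le_right _ _))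
  refine ⟨8 * ρs, by positivity, fun ρ hρ hρlt => ?_⟩
  -- run the ramp at density `ρ' = ρ/8`
  have hρ' : 0 < ρ / 8 := by positivity
  have hρ's : ρ / 8 < ρs := by linarith
  obtain ⟨c, hc, hcrit⟩ := hA' (ρ / 8) hρ' (hρ's.trans_le hsA)
  have hgap := hG' (ρ / 8) hρ' (hρ's.trans_le hsG)
  -- (T): the floor at `t = 0`, pointwise in `N` from the gap and the criterion
  have hfloor : ∀ᶠ N : ℕ in atTop, ENNReal.ofReal (c / 128 * N) ≤ coreOcc v 0 N (ρ / 8) :=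
    (hgap.and hcrit).mono fun N hN => hT v hv (ρ / 8) hρ' c hc N hN.1 hN.2
  -- the loss per step
  have hε : 0 < c / 512 := by positivity
  have hleg := hM' (ρ / 8) hρ' (hρ's.trans_le hsM) (c / 512) hε
  have hlim := hL' (ρ / 8) hρ' (hρ's.trans_le hsL)
  -- the transported floor at `t = ⊤`
  have key : ∀ᶠ N : ℕ in atTop, ENNReal.ofReal (c / 256 * N) ≤ coreOcc v ⊤ N (ρ / 8) := by
    filter_upwards [hfloor, hleg, hlim, eventually_gt_atTop 0] with N hf h1 h3 hN
    have hNr : (0 : ℝ) < N := Nat.cast_pos.2 hN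
    have hη : 0 < c / 512 * N := by positivity
    obtain ⟨t₀, ht₀⟩ := h3 (c / 512 * N) hη
    -- the two inequalities along the ramp: 0 → t₀ → ⊤
    have i1 := h1 t₀
    have i3 := ht₀ t₀ le_rfl
    set E := ENNReal.ofReal (c / 512 * N) with hE
    have chain : ENNReal.ofReal (c / 128 * N) ≤ coreOcc v ⊤ N (ρ / 8) + (E + E) :=
      calc ENNReal.ofReal (c / 128 * N) ≤ coreOcc v 0 N (ρ / 8) := hf
        _ ≤ coreOcc v ((t₀ : ℝ≥0) : ℝ≥0∞) N (ρ / 8) + E := i1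
        _ ≤ coreOcc v ⊤ N (ρ / 8) + E + E := add_le_add i3 le_rfl
        _ = coreOcc v ⊤ N (ρ / 8) + (E + E) := add_assoc _ _ _
    rw [hE, ofReal_split c hc N] at chain
    exact (ENNReal.add_le_add_iff_right (by finiteness)).1 chain
  -- (D): the Dirichlet endpoint at density `8 · ρ/8 = ρ`
  have h8 : HasGroundStateBEC v (8 * (ρ / 8)) := hD v hv (ρ / 8) hρ' ⟨c / 256, by positivity, key⟩
  have e : (8 : ℝ) * (ρ / 8) = ρ := by ring
  exact e ▸ h8

section Conclusions

variable
    (hG : ∀ v : ℝ → ℝ≥0∞, IsRepulsiveFiniteRange v → ∃ ρ₁ : ℝ, 0 < ρ₁ ∧ ∀ ρ' : ℝ, 0 < ρ' → ρ' < ρ₁ →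
      ∀ᶠ N : ℕ in atTop,
        2 * periodicGroundStateEnergy v N (sideLength ρ' N) < kyFanTwo v N (sideLength ρ' N))
    (hT : ∀ v : ℝ → ℝ≥0∞, IsRepulsiveFiniteRange v → ∀ ρ' : ℝ, 0 < ρ' → ∀ c : ℝ, 0 < c → ∀ N : ℕ,
      2 * periodicGroundStateEnergy v N (sideLength ρ' N) < kyFanTwo v N (sideLength ρ' N) →
      (∃ δ : ℝ≥0∞, 0 < δ ∧ ∀ Ψ : PeriodicTrialState N (sideLength ρ' N),
          periodicEnergy v Ψ ≤ periodicGroundStateEnergy v N (sideLength ρ' N) + δ →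
            ENNReal.ofReal (c * N) ≤ condensateOccupation N (sideLength ρ' N) Ψ.ψ) →
      ENNReal.ofReal (c / 128 * N) ≤ coreOcc v 0 N ρ')
    (hM : ∀ v : ℝ → ℝ≥0∞, IsRepulsiveFiniteRange v → ∃ ρ₁ : ℝ, 0 < ρ₁ ∧ ∀ ρ' : ℝ, 0 < ρ' → ρ' < ρ₁ →
      ∀ ε : ℝ, 0 < ε → ∀ᶠ N : ℕ in atTop, ∀ t : ℝ≥0,
        coreOcc v 0 N ρ' ≤ coreOcc v (t : ℝ≥0∞) N ρ' + ENNReal.ofReal (ε * N))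
    (hL : ∀ v : ℝ → ℝ≥0∞, IsRepulsiveFiniteRange v → ∃ ρ₁ : ℝ, 0 < ρ₁ ∧ ∀ ρ' : ℝ, 0 < ρ' → ρ' < ρ₁ →
      ∀ᶠ N : ℕ in atTop, ∀ η : ℝ, 0 < η → ∃ t₀ : ℝ≥0, ∀ t : ℝ≥0, t₀ ≤ t →
        coreOcc v (t : ℝ≥0∞) N ρ' ≤ coreOcc v ⊤ N ρ' + ENNReal.ofReal η)
    (hD : ∀ v : ℝ → ℝ≥0∞, IsRepulsiveFiniteRange v → ∀ ρ' : ℝ, 0 < ρ' →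
      (∃ c : ℝ, 0 < c ∧ ∀ᶠ N : ℕ in atTop, ENNReal.ofReal (c * N) ≤ coreOcc v ⊤ N ρ') →
        HasGroundStateBEC v (8 * ρ'))
include hG hT hM hL hD

/-- **`BoundaryTransferWeak_of`** — the five stubs imply the crux BY NAME (the item's registered decl
`Theses.BECPeriodicReduction.BoundaryTransferWeak`; hypotheses = the stub statements, verbatim).
[folklore] -/
theorem BoundaryTransferWeak_of :
    Summit.AtomisticToContinuum.BoseEinsteinCondensation.Theses.BECPeriodicReduction.BoundaryTransferWeak :=
  boundaryTransfer_of_stubs hG hT hM hL hD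

/-- The same composition concluding the PRIMARY planning route's copy of the crux,
`Theses.BECInsertionCorrector.BoundaryTransferWeak` (verbatim the same statement). [folklore] -/
theorem BoundaryTransferWeak_of_insertionCorrector :
    Summit.AtomisticToContinuum.BoseEinsteinCondensation.Theses.BECInsertionCorrector.BoundaryTransferWeak :=
  boundaryTransfer_of_stubs hG hT hM hL hD

/-- The same composition concluding the copy of the crux in route `BECGroundStateSOS` (the route of
lead c3), `Theses.BECGroundStateSOS.BoundaryTransferWeak` (verbatim the same statement). [folklore] -/
theorem BoundaryTransferWeak_of_groundStateSOS :
    Summit.AtomisticToContinuum.BoseEinsteinCondensation.Theses.BECGroundStateSOS.BoundaryTransferWeak :=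
  boundaryTransfer_of_stubs hG hT hM hL hD

end Conclusions

/-- **The line closes the crux from its stubs** (sorries = the three open stubs, nowhere else). [folklore] -/
theorem BoundaryTransferWeak_proof :
    Summit.AtomisticToContinuum.BoseEinsteinCondensation.Theses.BECPeriodicReduction.BoundaryTransferWeak :=
  BoundaryTransferWeak_of stub_torusGap stub_torusCoreFloor stub_rimMonotone stub_hardWallLimit
    stub_dirichletEndpoint

/-- The line closes the `BECGroundStateSOS` copy of the crux from its stubs (lead c3's route).
[folklore] -/
theorem BoundaryTransferWeak_proof_groundStateSOS :
    Summit.AtomisticToContinuum.BoseEinsteinCondensation.Theses.BECGroundStateSOS.BoundaryTransferWeak :=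
  BoundaryTransferWeak_of_groundStateSOS stub_torusGap stub_torusCoreFloor stub_rimMonotone
    stub_hardWallLimit stub_dirichletEndpoint

end Summit.AtomisticToContinuum.BoseEinsteinCondensation.RimSqueeze.Line

end
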